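import Mathlib.Analysis.InnerProductSpace.Harmonic.Constructions
import Mathlib.Analysis.InnerProductSpace.Calculus
import Mathlib.Analysis.InnerProductSpace.PiL2
import Mathlib.Analysis.Calculus.FDeriv.Symmetric
import Literature.Geometry.Symplectic.StandardEnd
import Literature.Geometry.Symplectic.SteinBall
import HarnessLib

/-!
# Stub `stub_bubbleConfinement` of line `Sketch` (pencil-incompleteness), crux `WitnessCharge`
(item stmt-SmoothPoincare4-7824, route `SullivanDual`) — part 2: **flat `J₀`-holomorphic maps
are harmonic, and `‖w‖²` is subharmonic along them**.

For a real inner product space `E`, an endomorphism `J₀ : E →L[ℝ] E` with `J₀² = -1`, and a map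
`w : ℂ → E` which is `C²` at `z` and satisfies the flat `J₀`-holomorphicity
`Dw(x)(i v) = J₀ (Dw(x) v)` near `z` (Hummel 1997, Ch. I §3, eq. (3.1) in one chart):

* `fderiv_fderiv_add_eq_zero_of_jHolomorphic` — **`w` is harmonic**:
  `D²w(z)(1,1) + D²w(z)(i,i) = 0` (`w_t = J₀ w_s ⇒ w_tt = J₀ w_st = J₀ w_ts = J₀² w_ss = -w_ss`,
  symmetry of second derivatives);
* `laplacian_norm_sq_eq` — for any `C²` map, `Δ ‖w‖² = 2(‖w_s‖² + ‖w_t‖²) + 2⟪w, Δ w⟫`;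
* `laplacian_norm_sq_of_jHolomorphic` — hence **`Δ ‖w‖² = 2(‖w_s‖² + ‖w_t‖²) ≥ 0`**, with
  equality only where `Dw = 0` (`clm_eq_zero_of_apply_one_of_apply_I`).

And two small facts for the main file: the crux's clause "`⟪A (J v), b⟫ = ω₀(A v, b)` for all `b`"
reads `A (J v) = J₀ (A v)` for the tree's standard complex structure
`J₀ = Literature.Geometry.Symplectic.stdComplexStructure` of `ℝ⁴ = ℂ²` (`SteinBall.lean`;
McDuff–Salamon 2017, §4.5: `ω₀(·, ·) = ⟨J₀ ·, ·⟩`), `eq_stdComplexStructure_of_forall_inner`; and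
a closed chart ball whose chart image lies in the chart target is closed
(`isClosed_closedChartBall`).

References: C. Hummel, *Gromov's compactness theorem for pseudo-holomorphic curves* (1997),
Ch. I §3 [Hummel1997]; D. McDuff, D. Salamon, *Introduction to symplectic topology*, 3rd ed.
(2017), §4.5 [McDuffSalamon2017].
-/

noncomputable section

-- the registered namespace `Summit.SmoothPoincare4.SmoothPoincare4.…` repeats a component
set_option linter.dupNamespace false

open scoped Topology RealInnerProductSpace Manifold
open Set Filter Laplacian InnerProductSpace Complex

namespace Summit.SmoothPoincare4.SmoothPoincare4.Theorems.WitnessCharge.PencilIncompleteness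

/-! ### Second derivatives of maps `ℂ → E` -/

section General

variable {E : Type*} [NormedAddCommGroup E] [InnerProductSpace ℝ E]

/-- Evaluating before or after differentiating: `D(x ↦ Dw(x) a)(z) v = D²w(z)(v)(a)`. [folklore] -/
theorem fderiv_fderiv_apply_comm {W : ℂ → E} {z : ℂ} (hW2 : DifferentiableAt ℝ (fderiv ℝ W) z)
    (a v : ℂ) : fderiv ℝ (fun x => fderiv ℝ W x a) z v = fderiv ℝ (fderiv ℝ W) z v a := by
  rw [fderiv_clm_apply hW2 (differentiableAt_const a)]
  simp

/-- A `C²` map has a differentiable derivative. [folklore] -/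
theorem differentiableAt_fderiv_of_contDiffAt {W : ℂ → E} {z : ℂ} (hW : ContDiffAt ℝ 2 W z) :
    DifferentiableAt ℝ (fderiv ℝ W) z :=
  (hW.fderiv_right (m := 1) le_rfl).differentiableAt one_ne_zero

/-- **Flat `J₀`-holomorphic maps are harmonic.**  If `J₀² = -1`, `w` is `C²` at `z` and
`Dw(x)(i v) = J₀ (Dw(x) v)` for `x` near `z`, then `D²w(z)(1,1) + D²w(z)(i,i) = 0`.
[cite: Hummel1997, Ch. I §3] -/
theorem fderiv_fderiv_add_eq_zero_of_jHolomorphic {W : ℂ → E} {J₀ : E →L[ℝ] E}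
    (hJ : ∀ a, J₀ (J₀ a) = -a) {z : ℂ} (hW : ContDiffAt ℝ 2 W z)
    (hhol : ∀ᶠ x in 𝓝 z, ∀ v : ℂ, fderiv ℝ W x (I * v) = J₀ (fderiv ℝ W x v)) :
    fderiv ℝ (fderiv ℝ W) z 1 1 + fderiv ℝ (fderiv ℝ W) z I I = 0 := by
  have hd2 : DifferentiableAt ℝ (fderiv ℝ W) z := differentiableAt_fderiv_of_contDiffAt hW
  have key : ∀ v v' : ℂ,
      fderiv ℝ (fderiv ℝ W) z v' (I * v) = J₀ (fderiv ℝ (fderiv ℝ W) z v' v) := by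
    intro v v'
    have heq : (fun x => fderiv ℝ W x (I * v)) =ᶠ[𝓝 z] fun x => J₀ (fderiv ℝ W x v) :=
      hhol.mono fun x hx => hx v
    have hd : DifferentiableAt ℝ (fun x => fderiv ℝ W x v) z :=
      hd2.clm_apply (differentiableAt_const v)
    have h2 : fderiv ℝ (fun x => J₀ (fderiv ℝ W x v)) z v' =
        J₀ (fderiv ℝ (fderiv ℝ W) z v' v) := by
      rw [show (fun x => J₀ (fderiv ℝ W x v)) = J₀ ∘ fun x => fderiv ℝ W x v from rfl,
        fderiv_comp z J₀.differentiableAt hd, J₀.fderiv, ContinuousLinearMap.comp_apply,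
        fderiv_fderiv_apply_comm hd2]
    rw [← fderiv_fderiv_apply_comm hd2, heq.fderiv_eq, h2]
  have hsymm : IsSymmSndFDerivAt ℝ W z := hW.isSymmSndFDerivAt (by simp)
  have e1 : fderiv ℝ (fderiv ℝ W) z I I = J₀ (fderiv ℝ (fderiv ℝ W) z I 1) := by
    simpa using key 1 I
  have e2 : fderiv ℝ (fderiv ℝ W) z 1 I = J₀ (fderiv ℝ (fderiv ℝ W) z 1 1) := by
    simpa using key 1 1
  rw [e1, hsymm I 1, e2, hJ, add_neg_cancel]

/-- **`Δ ‖w‖² = 2(‖w_s‖² + ‖w_t‖²) + 2⟪w, Δ w⟫`** for a `C²` map `w : ℂ → E`. [folklore] -/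
theorem laplacian_norm_sq_eq {W : ℂ → E} {z : ℂ} (hW : ContDiffAt ℝ 2 W z) :
    Δ (fun x => ‖W x‖ ^ 2) z = 2 * (‖fderiv ℝ W z 1‖ ^ 2 + ‖fderiv ℝ W z I‖ ^ 2)
      + 2 * ⟪W z, fderiv ℝ (fderiv ℝ W) z 1 1 + fderiv ℝ (fderiv ℝ W) z I I⟫ := by
  have hN : ContDiffAt ℝ 2 (fun x => ‖W x‖ ^ 2) z := hW.norm_sq ℝ
  have hdN : DifferentiableAt ℝ (fderiv ℝ fun x => ‖W x‖ ^ 2) z :=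
    differentiableAt_fderiv_of_contDiffAt hN
  have hd2 : DifferentiableAt ℝ (fderiv ℝ W) z := differentiableAt_fderiv_of_contDiffAt hW
  have hWz : DifferentiableAt ℝ W z := hW.differentiableAt two_ne_zero
  have hWd : ∀ᶠ x in 𝓝 z, DifferentiableAt ℝ W x :=
    (hW.eventually (by simp)).mono fun x hx => hx.differentiableAt two_ne_zero
  have step : ∀ a : ℂ, fderiv ℝ (fderiv ℝ fun x => ‖W x‖ ^ 2) z a a =
      2 * (⟪W z, fderiv ℝ (fderiv ℝ W) z a a⟫ + ⟪fderiv ℝ W z a, fderiv ℝ W z a⟫) := by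
    intro a
    have heq : (fun x => fderiv ℝ (fun x => ‖W x‖ ^ 2) x a) =ᶠ[𝓝 z]
        fun x => 2 * ⟪W x, fderiv ℝ W x a⟫ := by
      filter_upwards [hWd] with x hx
      rw [hx.hasFDerivAt.norm_sq.fderiv]
      simp [two_smul, two_mul]
    have hg : DifferentiableAt ℝ (fun x => fderiv ℝ W x a) z :=
      hd2.clm_apply (differentiableAt_const a)
    rw [← fderiv_fderiv_apply_comm hdN, heq.fderiv_eq, fderiv_const_mul (hWz.inner ℝ hg),
      FunLike.coe_smul, Pi.smul_apply, fderiv_inner_apply ℝ hWz hg,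
      fderiv_fderiv_apply_comm hd2, smul_eq_mul]
  rw [laplacian_eq_iteratedFDeriv_complexPlane]
  simp only [iteratedFDeriv_two_apply, Matrix.cons_val_zero, Matrix.cons_val_one]
  rw [step 1, step I, inner_add_right, real_inner_self_eq_norm_sq, real_inner_self_eq_norm_sq]
  ring

/-- **`‖w‖²` is subharmonic along a `J₀`-holomorphic map**: `Δ ‖w‖² = 2(‖w_s‖² + ‖w_t‖²)`.
[cite: McDuffSalamon2017, §4.5] -/
theorem laplacian_norm_sq_of_jHolomorphic {W : ℂ → E} {J₀ : E →L[ℝ] E}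
    (hJ : ∀ a, J₀ (J₀ a) = -a) {z : ℂ} (hW : ContDiffAt ℝ 2 W z)
    (hhol : ∀ᶠ x in 𝓝 z, ∀ v : ℂ, fderiv ℝ W x (I * v) = J₀ (fderiv ℝ W x v)) :
    Δ (fun x => ‖W x‖ ^ 2) z = 2 * (‖fderiv ℝ W z 1‖ ^ 2 + ‖fderiv ℝ W z I‖ ^ 2) := by
  rw [laplacian_norm_sq_eq hW, fderiv_fderiv_add_eq_zero_of_jHolomorphic hJ hW hhol,
    inner_zero_right, mul_zero, add_zero]

/-- A real-linear map on `ℂ` vanishing at `1` and at `i` vanishes. [folklore] -/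
theorem clm_eq_zero_of_apply_one_of_apply_I {F : Type*} [AddCommGroup F] [Module ℝ F]
    [TopologicalSpace F] (L : ℂ →L[ℝ] F) (h1 : L 1 = 0) (hI : L I = 0) : L = 0 := by
  ext w
  have hw : w = (w.re : ℝ) • (1 : ℂ) + (w.im : ℝ) • I := by
    rw [Complex.real_smul, Complex.real_smul, mul_one, Complex.re_add_im]
  rw [hw, map_add, map_smul, map_smul, h1, hI, smul_zero, smul_zero, add_zero]
  rfl

end General

/-! ### The standard complex structure of `ℝ⁴` and the form `ω₀` -/

section StandardR4

open Literature.Geometry.Symplectic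

/-- If `⟪x, b⟫ = ω₀(y, b)` for all `b`, then `x = J₀ y` for the tree's standard complex structure
`J₀ = stdComplexStructure` of `ℝ⁴ = ℂ²` (`J₀ (a₀, a₁, a₂, a₃) = (-a₁, a₀, -a₃, a₂)`,
`Literature/Geometry/Symplectic/SteinBall.lean`), because `⟪J₀ a, b⟫ = ω₀(a, b)`
(McDuff–Salamon 2017, §4.5: `ω₀ = ⟨J₀ ·, ·⟩`). [cite: McDuffSalamon2017, §4.5] -/
theorem eq_stdComplexStructure_of_forall_inner {x y : EuclideanSpace ℝ (Fin 4)}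
    (h : ∀ b : EuclideanSpace ℝ (Fin 4), ⟪x, b⟫ = stdSymplecticForm y b) :
    x = stdComplexStructure y := by
  refine ext_inner_right ℝ fun b => ?_
  rw [h b, EuclideanSpace.inner_eq_star_dotProduct]
  simp [dotProduct, Fin.sum_univ_four, stdSymplecticForm]
  ring

end StandardR4

/-! ### Closed chart balls -/

section ChartBalls

variable {M : Type*} [TopologicalSpace M] [T2Space M] [ChartedSpace (EuclideanSpace ℝ (Fin 4)) M]

/-- If the closed ball `B̄(e p, r)` lies in the chart target, the closed chart ball
`{y ∈ (chartAt p).source | e y ∈ B̄(e p, r)} = e⁻¹(B̄(e p, r))` is compact, hence closed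
(`M` Hausdorff). [folklore] -/
theorem isClosed_closedChartBall (p : M) {r : ℝ}
    (hball : Metric.closedBall (extChartAt (𝓡 4) p p) r ⊆ (extChartAt (𝓡 4) p).target) :
    IsClosed {y : M | y ∈ (chartAt (EuclideanSpace ℝ (Fin 4)) p).source ∧
      extChartAt (𝓡 4) p y ∈ Metric.closedBall (extChartAt (𝓡 4) p p) r} := by
  set e := extChartAt (𝓡 4) p with he
  have hset : {y : M | y ∈ (chartAt (EuclideanSpace ℝ (Fin 4)) p).source ∧
      e y ∈ Metric.closedBall (e p) r} = e.symm '' Metric.closedBall (e p) r := by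
    ext y
    constructor
    · rintro ⟨hy, hyb⟩
      refine ⟨e y, hyb, e.left_inv ?_⟩
      rw [he, extChartAt_source]
      exact hy
    · rintro ⟨q, hq, rfl⟩
      have hqt : q ∈ e.target := hball hq
      refine ⟨?_, ?_⟩
      · have h1 := e.map_target hqt
        rw [he, extChartAt_source] at h1
        exact h1
      · show e (e.symm q) ∈ Metric.closedBall (e p) r
        rw [e.right_inv hqt]
        exact hq
  rw [hset]
  exact ((isCompact_closedBall _ _).image_of_continuousOn
    ((continuousOn_extChartAt_symm (I := 𝓡 4) p).mono hball)).isClosed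

end ChartBalls

/-! ### The registered sub-goal -/

/-- Registered sub-goal form of `laplacian_norm_sq_of_jHolomorphic` on `ℝ⁴` (explicit binders,
Mathlib's `Laplacian.laplacian`, `Filter.Eventually`): along a flat `J₀`-holomorphic `C²` map
`W : ℂ → ℝ⁴` (`J₀² = -1`), `Δ ‖W‖² = 2(‖W_s‖² + ‖W_t‖²)`. [cite: McDuffSalamon2017, §4.5] -/
theorem stub_bubbleConfinement_laplacianNormSq :
    ∀ (J₀ : EuclideanSpace ℝ (Fin 4) →L[ℝ] EuclideanSpace ℝ (Fin 4)),
      (∀ a : EuclideanSpace ℝ (Fin 4), J₀ (J₀ a) = -a) →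
      ∀ (W : ℂ → EuclideanSpace ℝ (Fin 4)) (z : ℂ), ContDiffAt ℝ 2 W z →
      Filter.Eventually (fun x : ℂ => ∀ v : ℂ,
        fderiv ℝ W x (Complex.I * v) = J₀ (fderiv ℝ W x v)) (nhds z) →
      Laplacian.laplacian (fun x : ℂ => ‖W x‖ ^ 2) z =
        2 * (‖fderiv ℝ W z 1‖ ^ 2 + ‖fderiv ℝ W z Complex.I‖ ^ 2) :=
  fun _ hJ _ _ hW hhol => laplacian_norm_sq_of_jHolomorphic hJ hW hhol

end Summit.SmoothPoincare4.SmoothPoincare4.Theorems.WitnessCharge.PencilIncompleteness
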